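import Mathlib
import HarnessLib
import HarnessLib.Audit
import Summits.CriticalPhenomena.Statement
import Literature.Probability.Percolation.CardyFormula
import HarnessLib.Audit.Status.Attr

/-!
Route: PivotalEnergyLaw

DORMANT since 2026-08-24T08:02:07Z (reconciler: no traction for 6.6 d (last activity item-evidence-added at 2026-08-17T16:53:14Z); parked, not closed — `ledger route dormant route-CriticalPhenomena-PivotalEnergyLaw --off` to reactivate) — unstaffed, not closed; items shared with open routes are served there. `ledger route dormant <id> --off` reactivates.

# Route PivotalEnergyLaw — boundary-push energy law; CI as covariance along conformal blow-up paths;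
rectangle rungs typed now

It suffices to show X = ConformalDilationCovariance (card pivotal-energy-law, made typable): for
every map φ univalent
near a closed disc D̄ = closedBall c ρ, every interior point p and every marked 4-tuple y on ∂D, the
bond-ℤ² crossing
probabilities of the conformal images φ(p + s(D − p)) (marks φ(p + s(y − p))), READ AT MESH s·δ, are
asymptotically
independent of s ∈ (0,1] as δ → 0⁺. Along this "blow-up path" the modulus is constant by
construction and the normal
velocity of the boundary is (conformal dilation) − (Euclidean dilation); by Russo's formula dP/ds is
the integral of that
velocity against the boundary push-response (3-arm, "pivotal") density ρ_δ, and by Hadamard the same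
integral against
|∇u|² vanishes — so X is exactly the integrated form of the card's energy law ρ_δ ⇀ c·|∇u|² on
analytic quads, with no
potential theory in the statement. X plus three known-technology supports (NearRoundContinuity,
DiscRotationInvariance =
DKKMO, InnerApproximation = Bollobás–Riordan Ch. 7 on ℤ²) and the two shared cruxes of route
CardyUniqueLimit
(LimitExists, CardyRigidity) give CardyFormulaZ2. The card's rectangle ladder is filed as typed
lattice statements over
`crossingProb half N M` and one-column pushes: SideFlatness (crux), CornerMatching (crux),
RectVirial and
ResponseTightness (support).
Lean: `∀ (U : Set ℂ) (φ : ℂ → ℂ) (c p : ℂ) (ρ : ℝ) (θ : Fin 4 → ℝ), IsOpen U → DifferentiableOn ℂ φ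
U → Set.InjOn φ U → 0 < ρ → Metric.closedBall c ρ ⊆ U → p ∈ Metric.ball c ρ → StrictMono θ → θ 3 < θ
0 + 2 * Real.pi → ∀ s t : ℝ, s ∈ Set.Ioc (0:ℝ) 1 → t ∈ Set.Ioc (0:ℝ) 1 → ∀ R R' :
Literature.Probability.RandomPlanarGeometry.ConformalRectangle, (R.carrier = φ '' Metric.ball (p + s
* (c - p)) (s * ρ) ∧ ∀ i, R.pt i = φ (p + s * (c + ρ * Complex.exp (Complex.I * θ i) - p))) →
(R'.carrier = φ '' Metric.ball (p + t * (c - p)) (t * ρ) ∧ ∀ i, R'.pt i = φ (p + t * (c + ρ *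
Complex.exp (Complex.I * θ i) - p))) → Filter.Tendsto (fun δ : ℝ =>
Literature.Probability.Percolation.bondDomainCrossingProb R (s * δ) -
Literature.Probability.Percolation.bondDomainCrossingProb R' (t * δ)) (nhdsWithin 0 (Set.Ioi 0))
(nhds 0)`

## Assembly
Given the six antecedents, fix R with uniformizing (φ, x), η = crossRatio x. InnerApproximation: an
interior analytic quad
φ(D), D = ball c ρ ⋐ ℍ with marks of complex cross-ratio η, has crossing probabilities eventually
ε-close to R's (the
assembly constructs the presenting ConformalRectangle: boundary t ↦ φ(c + ρe^{2πit}), frontier by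
compactness +
open mapping). ConformalDilationCovariance (p = c, s = 1, t → 0) moves to φ(ball(c,tρ)) read at mesh
tδ; the exact
lattice scaling identity bondDomainCrossingProb (t⁻¹Ω) δ = bondDomainCrossingProb Ω (tδ) (meshPoint
is linear) turns this
into the unit-size quad φ(c)/t + φ′(c)·ψ_t(D) with ψ_t → id in C¹(D̄); NearRoundContinuity (at
angles θ + arg φ′(c), after
exact scaling by |φ′(c)|⁻¹ and conjugating the rotation into ψ) replaces it by a round marked disc;
a disc automorphism M
(ConformalDilationCovariance with φ = M, then NearRoundContinuity again) and DiscRotationInvariance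
carry it to the fixed
reference disc D_η; LimitExists at D_η defines f(η) and gives P R δ → f(η), i.e. X_U = ∃ f ∀ R,
HasCrossingLimit; CardyRigidity
gives f = cardyFunction on (0,1) ∋ η (crossRatio_mem_Ioo_of_isUniformizing), hence CardyFormulaZ2.
No percolation estimate
is used inside the assembly; its Lean cost is the constructions of presenting structures and the
scaling identity.

Rationale: WHY THIS LINE. Mechanism (card pivotal-energy-law; GarbanPeteSchramm2013 for the 𝕋-side forward
direction, FriedrichWerner2003 for the
continuum "variation of the domain = stress tensor" reading, Cardy1992): conformal invariance of
crossing probabilities is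
equivalent to ONE local law for the boundary push-response density, ρ = c(m)|∇u|² (u the extremal
Dirichlet–Neumann
potential), because Russo's formula makes the response to a one-row push an exact boundary sum and
Hadamard's formula
makes |∇u|²ds the gradient of the modulus. Planner's additions that turn the card into a route: (i)
the law is stated in
integrated, u-free form along the canonical isomodular BLOW-UP PATH s ↦ s⁻¹·φ(p + s(D − p)) of
univalent-function theory
(f(λz)/λ), which joins every analytic quad to a round marked disc, so "energy law ⇒ CI" needs no
Riemann-mapping input
and no path-connectedness of modulus fibres; (ii) responses are DOMAIN pushes (differences of
crossing probabilities), not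
edge-pivotal probabilities, which removes the lattice-direction anisotropy factor; (iii) the corner
symmetry is made
exact: T(x,y) = (y + N − M − ½, x + M − N + ½) swaps the primal quadrant at a corner with the dual
quadrant, so
reflection∘duality is an exact local symmetry of bond-ℤ² at every rectangle corner (CornerMatching).
Imported areas:
geometric function theory (Hadamard variation, Koebe blow-up of univalent maps), electrostatics
dictionary (push response
↔ energy density |∇u|²), near-critical/arm technology on ℤ² (Kesten1987, LawlerSchrammWernerEJP2002,
Nolin2008,
SchrammSmirnov2011). What prior routes do not do: CardyUniqueLimit leaves X_U undecomposed;
CardyRotToConf/ViaSLE6 go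
through curve laws; HarmonicInvariants/DiscreteHolo need an observable; Isoradial transports from an
anchor. This route
attacks X_U through a scalar boundary density and gives it a typed lattice laboratory (rectangles)
where the first
relations (corner matching, virial identity) are provable or cheaply falsifiable now. Negatives
index (1 entry, SAW
parafermion tightness) is untouched.

RANKED CRUXES. #2 ConformalDilationCovariance (crux) — for U open ⊇ closedBall c ρ, φ holomorphic
and injective on U, p ∈ ball c ρ, marks at angles θ₀<θ₁<θ₂<θ₃<θ₀+2π, and s,t ∈ (0,1]: any conformal
rectangles R, R' presenting φ(ball(p+s(c−p), sρ)) with marks φ(p+s(y_i−p)) resp. the t-versions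
satisfy bondDomainCrossingProb R (sδ) − bondDomainCrossingProb R' (tδ) → 0 as δ → 0⁺ (card:
EnergyLaw, integrated along the blow-up path; φ affine gives translation invariance as a special
case). [difficulty: open-problem] (why it might fail: It is conformal-invariance content (CI ⇒ it;
with the supports it ⇒ X_U): false iff bond-ℤ² sublimits are not CI. As a ROUTE step: no mechanism
beyond corners/strip-mixing forces ρ_δ ⇀ c|∇u|²; EmbeddingModulusUniqueness forbids shear-blind
proofs.) [GarbanPeteSchramm2013, FriedrichWerner2003, Beffara2008Universal, SchrammSmirnov2011,
Cardy1992, Smirnov2001]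
#3 SideFlatness (crux) — rectangle rung of the energy law (u linear, |∇u|² constant): on [0,N]×[0,M]
⊂ ℤ² (LR crossing, P = crossingProb half N M), the response to pushing the wired right side out by
one column over a window of ℓ rows is (ℓ/(M+1))·(P(N,M) − P(N+1,M)) + o(1/N), and the response to
pushing the free top side up by one row over ℓ columns is (ℓ/(N+1))·(P(N,M+1) − P(N,M)) + o(1/N),
uniformly over windows and aspect ratios in [1/2,2] (card Crux 1, without the unsupported "⇔
LimitExists"). [difficulty: open-problem] (why it might fail: Flat push-response along a side is
local translation invariance of a boundary 3-arm density at distance ~M from two corners: CI content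
with no mechanism except strip mixing (far from corners) and CornerMatching (at corners); the o(1/N)
additivity over windows needs two-contact events to be O(δ²).) [Cardy1992, Kesten1987,
SmirnovWerner2001, GrimmettPercolation1999, arXiv:1008.1378]
#4 CornerMatching (crux) — near the top-right corner of [0,N]×[0,M], the one-column push response of
a window of ℓ rows on the wired right side at distance j from the corner and the one-row push
response of a window of ℓ columns on the free top side at the same distance agree to relative error
ε, for j ≥ j₀(ε), 1 ≤ ℓ ≤ j, N, M ≥ N₀(j,ℓ), aspect in [1/2,2] (card's provable lemma: the far arms
— open to the left side, dual to the bottom side — are the same event; inside the j-ball the exact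
symmetry T = reflection∘duality of the corner exchanges the two local 3-arm configurations).
[difficulty: L] (why it might fail: Ratio → 1 (not just ≍) needs a coupling/ratio-limit of the far
two-arm configuration given different inner faces (GPS-type separation on ℤ²) and slow variation of
the density in j; T shifts windows by O(1) sites, harmless only if consecutive-j densities have
ratio → 1.) [GarbanPeteSchramm2013, Kesten1987, Nolin2008, LawlerSchrammWernerEJP2002,
GrimmettPercolation1999]
#5 LimitExists (crux) — shared with route CardyUniqueLimit (stmt-CriticalPhenomena-0747): for every
conformal rectangle the bond-ℤ² crossing probability converges as δ → 0⁺ (existence only). Used here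
only for reference marked discs; the card's claim "SideFlatness ⇔ LimitExists" is NOT adopted (an
o(1) Euler/virial identity does not sum to convergence — log log-type oscillations survive — so only
a RATE version could, see Two-layer plan). [difficulty: open-problem] (why it might fail: Only RSW
is known (cluster points in (0,1)); no monotonicity or sub-multiplicativity in δ, so p(δ) may
oscillate between two cluster points along δ=2^-k vs 3^-k (Grimmett1999 §11.10, Bollobás–Riordan
Ch.7 Conj. 1).) [GrimmettPercolation1999, BollobasRiordan2006,
lean:Literature.Probability.Percolation.discreteCrossingProb_clusterPt_mem_Ioo]
#6 CardyRigidity (crux) — shared with route CardyUniqueLimit (stmt-CriticalPhenomena-0746): if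
bond-ℤ² crossing probabilities of all conformal rectangles converge to a function f of the
cross-ratio then f = cardyFunction on (0,1) (locality ⇒ SLE₆ ⇒ Cardy). [difficulty: L] (why it might
fail: Vacuous unless X_U holds; as a theorem the Camia–Newman identification needs kernels on
admissible non-Jordan domains with moving mesh, more than fixed Jordan rectangles give directly
(CamiaNewman2007 Thm 2-3).) [CamiaNewman2007, Smirnov2001, Werner2007, SchrammSmirnov2011]
#9 NearRoundContinuity (support) — RSW equicontinuity at round quads, any position: for a marked
disc (c,ρ,θ) and ε > 0 there is τ > 0 such that for every ψ univalent near closedBall c ρ with |ψ′ −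
1| ≤ τ on it, any R presenting ψ(ball c ρ) with marks ψ(y_i) and any R₀ presenting the round marked
disc itself have eventually |P R δ − P R₀ δ| ≤ ε (covers translations ψ = z + w). Known technology:
Schramm–Smirnov / GPS uniform continuity of quad-crossing probabilities from RSW + boundary 3-arm
bounds, on bond-ℤ² via rsw_half_holds. [difficulty: L] [SchrammSmirnov2011, GarbanPeteSchramm2013,
BollobasRiordan2006, lean:Literature.Probability.Percolation.rsw_half_holds]
#9 DiscRotationInvariance (support) — for the unit disc with marks e^{iθ_j} and its rotation by α,
bond-ℤ² crossing probabilities differ by o(1) as δ → 0⁺ (DKKMO 2020 rotation invariance of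
sub-sequential limits, arXiv:2012.11672 Thm 1.2/Cor 1.3, transferred from the tree's loop form
dkkmo_rotation_invariance to crossing events of a disc by RSW). [difficulty: L]
[DKKMO2020Rotational, arXiv:2012.11672,
lean:Literature.Probability.Percolation.dkkmo_rotation_invariance]
#9 InnerApproximation (support) — for R with uniformizing datum (φ, x) and ε > 0 there is a marked
disc (c,ρ,θ) with closedBall c ρ ⊂ ℍ whose complex cross-ratio equals crossRatio x (so φ(disc) is an
interior analytic quad of the SAME modulus) such that every R' presenting φ(ball c ρ) with marks
φ(c+ρe^{iθ_j}) has eventually |P R δ − P R' δ| ≤ ε. Known technology: the ℤ²-bond analogue of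
Bollobás–Riordan Ch. 7 Lemma 14 / (19) (interior approximating domains + RSW near the marked
points), proved in the tree for site-𝕋 (tri_exists_discreteApprox_proof). [difficulty: L]
[BollobasRiordan2006, Smirnov2001, CamiaNewman2007,
lean:Literature.Probability.Percolation.hasCrossingLimit_triDomainCrossingProb_holds]
#9 RectVirial (support) — virial (scale-covariance) identity for rectangle pushes, the card's first
rung: (N+1)(P(N,M) − P(N+1,M)) − (M+1)(P(N,M+1) − P(N,M)) → 0 uniformly for aspect in [1/2,2]
("per-site wired-side density = per-site free-side density"; equivalently, by exact duality
P(N,M)+P(M+1,N−1)=1, symmetry of the top-push response under (N,M) ↔ (M+1,N−1)). Consequence of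
SideFlatness + CornerMatching + ResponseTightness (glue foreseen); cheap transfer-matrix / kit
target on its own. [difficulty: open-problem] [Cardy1992, GrimmettPercolation1999,
lean:Literature.Probability.Percolation.crossingProb_anti_left]
#9 ResponseTightness (support) — the one-column push response of the wired side is of exact order
1/N: c/N ≤ P(N,M) − P(N+1,M) ≤ C/N for aspect in [1/2,2] and N ≥ N₀ (tightness and non-degeneracy of
the boundary push-response measure; upper bound = half-plane 3-arm exponent 2 plus a corner 2-arm
bound, lower bound = RSW average + regularity of the reach law). [difficulty: M]
[LawlerSchrammWernerEJP2002, SmirnovWerner2001, Nolin2008, Werner2007,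
lean:Literature.Probability.Percolation.rsw_half_holds]

TWO-LAYER PLAN. Foreseen glued splits (none filed now). ConformalDilationCovariance ⇐
RussoHadamardIdentity (exact lattice: d/ds of the
blow-up family = signed boundary sum of one-row push responses against the discretised velocity) →
BoundaryEnergyLaw
(push-response measures of analytic lattice quads are tight, O(δ²) per site, and every subsequential
limit is
c·|∇u|²ds; CornerMatching/SideFlatness are its rectangle shadows) → ConformalDilationCovariance
(pure analysis: the
blow-up velocity integrates |∇u|² to dm/ds = 0). RectVirial ⇐ SideFlatness → CornerMatching →
RectVirial (with
ResponseTightness). A RATE version VirialRate (defect O(N^-θ)) + reach-law regularity ⇒ LimitExists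
for lattice rectangles
is the only honest remnant of the card's "SideFlatness ⇔ LimitExists" and would be filed as a child
of LimitExists.

KILL CRITERIA. ¬SideFlatness or ¬RectVirial established numerically beyond error bars at N ~ 256
(kit/transfer matrix) and then proved
⇒ the energy law fails already on rectangles ⇒ close `refuted:SideFlatness` (and CardyFormulaZ2
itself would be in doubt,
since CI + smooth finite-size corrections imply both). ¬CornerMatching proved ⇒ the local-symmetry
mechanism is dead;
pivot to strip-mixing only or close. ¬ConformalDilationCovariance ⇒ ¬CI ⇒ the conjunct is false as
typed (report).
X_U proved elsewhere (CardyRotToConf, CardyViaSLE6, CardyHarmonicInvariants) moots the spine but not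
the rectangle rungs.

NOT DECOMPOSED YET. The boundary push-response MEASURE of a general lattice quad and the discrete
extremal potential (definition requests
below) — hence BoundaryEnergyLaw and RussoHadamardIdentity stay prose; the corner 2-arm exponent in
a quadrant (enters
ResponseTightness's upper bound); the reach-law regularity lemma; the strip-mixing proof of flatness
far from corners;
uniformity of NearRoundContinuity in the modulus; everything about values (left to CardyRigidity).

CHEAPEST FALSIFIER. kit compute (not run: hub is compute-free and this is a one-shot plancard seat):
exact/transfer-matrix or 10⁹-sample Monte
Carlo of P(N,M), P(N+1,M), P(N,M+1) for N = M ∈ {32,…,512}: (i) RectVirial defect (N+1)ΔR − (M+1)ΔT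
must tend to 0
(CI with smooth corrections predicts O(N^-1)-O(N^-2)); (ii) window responses on the 2:1 rectangle:
flat along each side
within error bars and right/top per-site densities equal; (iii) CornerMatching ratio at j = 4, 8,
16. A refuter should
first check the exact duality bookkeeping ΔR(N,M) = ΔT(M+1,N−1) (from lrCrossing_xor_dualTBCrossing)
on N ≤ 6 by
enumeration — a sign/offset slip there would falsify the typed forms, not the idea.

NUMBERS. Half-plane arm exponents on ℤ² (universal): 2-arm = 1, 3-arm = 2
(LawlerSchrammWernerEJP2002 App. A; SmirnovWerner2001;
tree: LawlerSchrammWerner2002_halfPlane_threeArm gives 1+α on 𝕋 only). Boundary 3-arm operator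
φ_{1,5}: h = 2 at c = 0
(weight of T). Predicted densities at a corner of interior angle α: ρ ~ r^{2π/α − 2} (π/2: r²; 3π/2:
r^{-2/3}). Cardy:
F′(η) = [3Γ(2/3)/Γ(1/3)²](η(1−η))^{-2/3}; exact lattice identities used: P(n+1,n) = 1/2, P(N,M) +
P(M+1,N−1) = 1.
Items at open: 11 (5 crux, 5 support, 1 assembly).

DEFINITION REQUESTS. To be filed after open (for the layer-2 children, not needed by any typed
item): `boundaryPushResponse` (signed one-row
push-response measure of a lattice quad (S; A, B) ⊂ ℤ², topic
Summits/CriticalPhenomena/CardyFormulaZ2/Theorems) and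
`discreteExtremalPotential` / `latticeConductance` (mixed Dirichlet–Neumann problem on
discreteDomainGraph, topic
Literature/Probability/LatticeModels). Cite fact wanted: GPS2013 Thm 1.1/§5 ratio-limit and coupling
statements in their
ℤ²-valid form.

Novelty: Searches (2026-08-15): card's audit (refuter-novelty-audit-…-2-0) read FriedrichWerner2003 p.4,
Doyon–Riva–Cardy
math-ph/0511054, Doyon 1209.1560, GPS arXiv:1008.1378, Kleban–Zagier; this seat: `lit search
--hybrid` ×4 ("Hadamard
variational formula crossing probability percolation boundary pivotal", "pivotal measure scaling
limit conformal
covariance", "crossing probability depends continuously on the domain uniformly in the mesh",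
"conformal invariance
crossing probabilities square lattice domain perturbation": textbook hits only — Lawler2005
pp.16-17,171,240; Kesten1982
p.336; BollobasRiordan2006 pp.165-183), `lit frontier CriticalPhenomena --since 2021` (30 rows; none
on boundary
variation of ℤ² crossings), `lit papers --grep Garban|Pete|pivotal` (0 held), remote `lit
search`/`lit galaxy` unavailable
this session (searchd connection reset ×5, galaxyd queue > 90 s) — flagged for the refuter's audit.
Nearest prior art found: GarbanPeteSchramm2013 (arXiv:1008.1378: conformal covariance of pivotal
measures on 𝕋, forward
direction from SLE₆), FriedrichWerner2003 (domain variation of SLE laws = stress-tensor insertions,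
continuum),
SchrammSmirnov2011 (quad-crossing equicontinuity), DKKMO2020Rotational (rotation invariance on ℤ²),
Beffara2008Universal
(Russo interpolation; embedding barrier).
Delta: the reverse, lattice-side use on ℤ² — conformal invariance of bond-ℤ² crossings typed as
covariance along the
Koebe blow-up path of an arbitrary univalent map (an isomodular one-para  [refs: 1008.1378, FriedrichWerner2003, Lawler2005, Kesten1982, BollobasRiordan2006, GarbanPeteSchramm2013, SchrammSmirnov2011]

Barriers (technique_class: hadamard-variation, boundary-pivotal, conformal-blowup): - technique_class: hadamard-variation, boundary-pivotal, conformal-blowup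
- Literature.Barriers.CriticalPhenomena.EmbeddingModulusUniqueness: APPLIES to
ConformalDilationCovariance, NearRoundContinuity, InnerApproximation and the assembly's X_U (all
refer to holomorphic maps / discs of ℂ ⊃ ℤ², i.e. to the square embedding; the covariance is false
for a sheared embedding's limit). Evasion (i) of the catalogue: embedding-specific inputs are
explicit — DKKMO rotation invariance (DiscRotationInvariance, tree dkkmo_rotation_invariance) and
the exact order-4 symmetry of ℤ² used through the corner map T = reflection∘duality
(CornerMatching); the intended proof of the energy law compares ρ_δ with the EUCLIDEAN Dirichlet
energy |∇u|², which a shear does not preserve, so no step is shear-blind. The lattice rungs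
(SideFlatness, CornerMatching, RectVirial, ResponseTightness) are statements about the abstract
graph ℤ² and lie outside the barrier's scope.
- Literature.Barriers.CriticalPhenomena.CoveringLatticeShift: shares only the token "Russo formula":
here Russo varies the DOMAIN at the fixed self-dual point p = 1/2 (one-row pushes), never the model,
so Beffara's q ↦ 1−q shift does not arise; Beffara's diagnosis (dependence of pivotal probabilities
on the boundary data is the missing estimate) is exactly what ρ_δ makes primary.
- Literature.Barriers.CriticalPhenomena.SmirnovTriangularOnly: not in class — no colour switching,
no harmonic triple, no discrete-holomorphic observable; Smirno

History (route lifecycle, newest last):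
- 2026-08-24T08:02:07Z · DORMANT — reconciler: no traction for 6.6 d (last activity item-evidence-added at 2026-08-17T16:53:14Z); parked, not closed — `ledger route dormant route-CriticalPhenomen (operator:999:2891729)

sub-problem: CardyFormulaZ2 · status: dormant · opened planner-plancard-CriticalPhenomena-CardyFormu-7b19392f-0 2026-08-15T11:34:51Z · rev 2 · ledger route-CriticalPhenomena-PivotalEnergyLaw
GENERATED by the gate from the ledger (D-0016/17). Provers cite these decls: `theorem foo : Summit.CriticalPhenomena.CardyFormulaZ2.Theses.PivotalEnergyLaw.<Decl> := …` in Summits/CriticalPhenomena/CardyFormulaZ2/Theorems/<Name>.lean.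
-/

namespace Summit.CriticalPhenomena.CardyFormulaZ2.Theses.PivotalEnergyLaw

open scoped BigOperators Topology Manifold Classical MeasureTheory ProbabilityTheory Matrix InnerProductSpace ComplexConjugate ContinuousMap
open Filter Set Function TopologicalSpace MeasureTheory

attribute [summit_statement] _root_.CardyFormulaZ2

/-- item stmt-CriticalPhenomena-4705 · crux · rank 2 · open · by planner
why it might fail: CI-strength content, open on ℤ² (Smirnov2001 closing remark); GPS13 §1 p.10: on ℤ² only RSW/separation/coupling survive, pivotal covariance needs the scaling limit. False iff a subsequential quad-crossing limit is not covariant along a Koebe blow-up path; no lattice mechanism forces ρ_δ ⇀ c|∇u|².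
sources: Smirnov2001, GarbanPeteSchramm2013, arXiv:1008.1378, SchrammSmirnov2011, Beffara2008Universal, DKKMO2020Rotational
[crux] for U open ⊇ closedBall c ρ, φ holomorphic and injective on U, p ∈ ball c ρ, marks at angles
θ₀<θ₁<θ₂<θ₃<θ₀+2π, and s,t ∈ (0,1]: any conformal rectangles R, R' presenting φ(ball(p+s(c−p), sρ))
with marks φ(p+s(y_i−p)) resp. the t-versions satisfy bondDomainCrossingProb R (sδ) −
bondDomainCrossingProb R' (tδ) → 0 as δ → 0⁺ (card: EnergyLaw, integrated along the blow-up path; φ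
affine gives translation invariance as a special case). [difficulty: open-problem] -/
@[route_item "route-CriticalPhenomena-PivotalEnergyLaw", crux]
def ConformalDilationCovariance : Prop :=
  ∀ (U : Set ℂ) (φ : ℂ → ℂ) (c p : ℂ) (ρ : ℝ) (θ : Fin 4 → ℝ), IsOpen U → DifferentiableOn ℂ φ U → Set.InjOn φ U → 0 < ρ → Metric.closedBall c ρ ⊆ U → p ∈ Metric.ball c ρ → StrictMono θ → θ 3 < θ 0 + 2 * Real.pi → ∀ s t : ℝ, s ∈ Set.Ioc (0:ℝ) 1 → t ∈ Set.Ioc (0:ℝ) 1 → ∀ R R' : Literature.Probability.RandomPlanarGeometry.ConformalRectangle, (R.carrier = φ '' Metric.ball (p + s * (c - p)) (s * ρ) ∧ ∀ i, R.pt i = φ (p + s * (c + ρ * Complex.exp (Complex.I * θ i) - p))) → (R'.carrier = φ '' Metric.ball (p + t * (c - p)) (t * ρ) ∧ ∀ i, R'.pt i = φ (p + t * (c + ρ * Complex.exp (Complex.I * θ i) - p))) → Filter.Tendsto (fun δ : ℝ => Literature.Probability.Percolation.bondDomainCrossingProb R (s * δ) - Literature.Probability.Percolation.bondDomainCrossingProb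 R' (t * δ)) (nhdsWithin 0 (Set.Ioi 0)) (nhds 0)

/-- item stmt-CriticalPhenomena-4706 · crux · rank 3 · open · by planner
why it might fail: o(1/N) window-additivity = local translation invariance of the boundary push-response/3-arm density: CI content on ℤ² (GPS13 §4.5 ratio limits use the 𝕋 scaling limit; Nolin08 β₃=2 only ≍); needs 1/N finite-size corrections smooth, straddling contact sets O(1/N²). Duality offsets l↦l±1 cost O(1/N²).
sources: Cardy1992, GarbanPeteSchramm2013, arXiv:1008.1378, Nolin2008, LawlerSchrammWernerEJP2002, KestenScalingCMP1987
[crux] rectangle rung of the energy law (u linear, |∇u|² constant): on [0,N]×[0,M] ⊂ ℤ² (LR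
crossing, P = crossingProb half N M), the response to pushing the wired right side out by one column
over a window of ℓ rows is (ℓ/(M+1))·(P(N,M) − P(N+1,M)) + o(1/N), and the response to pushing the
free top side up by one row over ℓ columns is (ℓ/(N+1))·(P(N,M+1) − P(N,M)) + o(1/N), uniformly over
windows and aspect ratios in [1/2,2] (card Crux 1, without the unsupported "⇔ LimitExists").
[difficulty: open-problem] -/
@[route_item "route-CriticalPhenomena-PivotalEnergyLaw", crux]
def SideFlatness : Prop :=
  ∀ (Pr Pt : ℕ → ℕ → ℕ → ℕ → ℝ), (∀ N M y l : ℕ, Pr N M y l = (Literature.Probability.Percolation.bondPercolation (Literature.Probability.LatticeModels.zdGraph 2) Literature.Probability.Percolation.half).real (Literature.Probability.Percolation.openCrossing {x : Literature.Probability.LatticeModels.Site 2 | (0 ≤ x 0 ∧ x 0 ≤ N ∧ 0 ≤ x 1 ∧ x 1 ≤ M) ∨ (x 0 = N + 1 ∧ (y : ℤ) ≤ x 1 ∧ x 1 < y + l)} {x | x 0 = 0 ∧ 0 ≤ x 1 ∧ x 1 ≤ M} {x | (x 0 = N + 1 ∧ (y : ℤ) ≤ x 1 ∧ x 1 < y +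 l) ∨ (x 0 = N ∧ 0 ≤ x 1 ∧ x 1 ≤ M ∧ ¬ ((y : ℤ) ≤ x 1 ∧ x 1 < y + l))})) → (∀ N M y l : ℕ, Pt N M y l = (Literature.Probability.Percolation.bondPercolation (Literature.Probability.LatticeModels.zdGraph 2) Literature.Probability.Percolation.half).real (Literature.Probability.Percolation.openCrossing {x : Literature.Probability.LatticeModels.Site 2 | (0 ≤ x 0 ∧ x 0 ≤ N ∧ 0 ≤ x 1 ∧ x 1 ≤ M) ∨ (x 1 = M + 1 ∧ (y : ℤ) ≤ x 0 ∧ x 0 < y + l)} {x | x 0 = 0 ∧ ((0 ≤ x 1 ∧ x 1 ≤ M) ∨ (x 1 = M + 1 ∧ (y : ℤ) ≤ 0 ∧ (0 : ℤ) < y + l))} {x | x 0 = N ∧ ((0 ≤ x 1 ∧ x 1 ≤ M) ∨ (x 1 = M + 1 ∧ (y : ℤ) ≤ N ∧ (N : ℤ) < y + l))})) → ∀ ε : ℝ, 0 < ε → ∃ N₀ : ℕ, ∀ N M : ℕ, N₀ ≤ N → N₀ ≤ M → M ≤ 2 * N → N ≤ 2 * M → (∀ y l : ℕ, y + l ≤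 M + 1 → |(Literature.Probability.Percolation.crossingProb Literature.Probability.Percolation.half N M - Pr N M y l) - (l / (M + 1) : ℝ) * (Literature.Probability.Percolation.crossingProb Literature.Probability.Percolation.half N M - Literature.Probability.Percolation.crossingProb Literature.Probability.Percolation.half (N + 1) M)| ≤ ε / N) ∧ (∀ y l : ℕ, y + l ≤ N + 1 → |(Pt N M y l - Literature.Probability.Percolation.crossingProb Literature.Probability.Percolation.half N M) - (l / (N + 1) : ℝ) * (Literature.Probability.Percolation.crossingProb Literature.Probability.Percolation.half N (M + 1) - Literature.Probability.Percolation.crossingProb Literature.Probability.Percolation.half N M)| ≤ ε / N)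

/-- item stmt-CriticalPhenomena-4707 · crux · rank 4 · open · by planner
why it might fail: FALSE as typed: at l=1 the top bump {(N−j,M+1)} is a dead end of S, so Pt N M (N−j) 1 = P(N,M) and the bound forces Pr N M (M−j) 1 = P(N,M), yet P−Pr ≥ 2^-#E(S) > 0 (row M−j open, rest closed). Duality maps an l-row wired push to an (l+1)-column free push: fixed-l ratio ↛ 1; needs l→∞ or the offset.
sources: lean:Literature.Probability.Percolation.openConnIn, lean:ProbabilityTheory.setBernoulli_ae_subset, lean:Literature.Probability.Percolation.lrCrossing_xor_dualTBCrossing, GrimmettPercolation1999, BollobasRiordan2006, GarbanPeteSchramm2013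
[crux] near the top-right corner of [0,N]×[0,M], the one-column push response of a window of ℓ rows
on the wired right side at distance j from the corner and the one-row push response of a window of ℓ
columns on the free top side at the same distance agree to relative error ε, for j ≥ j₀(ε), 1 ≤ ℓ ≤
j, N, M ≥ N₀(j,ℓ), aspect in [1/2,2] (card's provable lemma: the far arms — open to the left side,
dual to the bottom side — are the same event; inside the j-ball the exact symmetry T =
reflection∘duality of the corner exchanges the two local 3-arm configurations). [difficulty: L] -/
@[route_item "route-CriticalPhenomena-PivotalEnergyLaw", crux]
def CornerMatching : Prop :=
  ∀ (Pr Pt : ℕ → ℕ → ℕ → ℕ → ℝ), (∀ N M y l : ℕ, Pr N M y l = (Literature.Probability.Percolation.bondPercolation (Literature.Probability.LatticeModels.zdGraph 2) Literature.Probability.Percolation.half).real (Literature.Probability.Percolation.openCrossing {x : Literature.Probability.LatticeModels.Site 2 | (0 ≤ x 0 ∧ x 0 ≤ N ∧ 0 ≤ x 1 ∧ x 1 ≤ M) ∨ (x 0 = N + 1 ∧ (y : ℤ) ≤ x 1 ∧ x 1 < y + l)} {x | x 0 = 0 ∧ 0 ≤ x 1 ∧ x 1 ≤ M} {x | (x 0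 = N + 1 ∧ (y : ℤ) ≤ x 1 ∧ x 1 < y + l) ∨ (x 0 = N ∧ 0 ≤ x 1 ∧ x 1 ≤ M ∧ ¬ ((y : ℤ) ≤ x 1 ∧ x 1 < y + l))})) → (∀ N M y l : ℕ, Pt N M y l = (Literature.Probability.Percolation.bondPercolation (Literature.Probability.LatticeModels.zdGraph 2) Literature.Probability.Percolation.half).real (Literature.Probability.Percolation.openCrossing {x : Literature.Probability.LatticeModels.Site 2 | (0 ≤ x 0 ∧ x 0 ≤ N ∧ 0 ≤ x 1 ∧ x 1 ≤ M) ∨ (x 1 = M + 1 ∧ (y : ℤ) ≤ x 0 ∧ x 0 < y + l)} {x | x 0 = 0 ∧ ((0 ≤ x 1 ∧ x 1 ≤ M) ∨ (x 1 = M + 1 ∧ (y : ℤ) ≤ 0 ∧ (0 : ℤ) < y + l))} {x | x 0 = N ∧ ((0 ≤ x 1 ∧ x 1 ≤ M) ∨ (x 1 = M + 1 ∧ (y : ℤ) ≤ N ∧ (N : ℤ) < y + l))})) → ∀ ε : ℝ, 0 < ε → ∃ j₀ : ℕ, ∀ j l : ℕ, j₀ ≤ j → 1 ≤ l → l ≤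 j → ∃ N₀ : ℕ, ∀ N M : ℕ, N₀ ≤ N → N₀ ≤ M → M ≤ 2 * N → N ≤ 2 * M → |(Literature.Probability.Percolation.crossingProb Literature.Probability.Percolation.half N M - Pr N M (M + 1 - j - l) l) - (Pt N M (N + 1 - j - l) l - Literature.Probability.Percolation.crossingProb Literature.Probability.Percolation.half N M)| ≤ ε * (Pt N M (N + 1 - j - l) l - Literature.Probability.Percolation.crossingProb Literature.Probability.Percolation.half N M)

/-- item stmt-CriticalPhenomena-0747 · crux · rank 5 · open · by planner
why it might fail: Existence of the δ→0 limit of bond-ℤ² crossing probabilities is itself open (Grimmett1999 p.346: 'it is believed that the limit exists'; Bollobás–Riordan Ch.7 Conj.1): only RSW cluster points in (0,1) known, no monotonicity/sub-multiplicativity in δ, so oscillation along δ=2^-k vs 3^-k not excluded.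
sources: GrimmettPercolation1999, BollobasRiordan2006, SchrammSmirnov2011, lean:Literature.Probability.Percolation.discreteCrossingProb_clusterPt_mem_Ioo
[crux] Existence of the scaling limit of bond-Z^2 crossing probabilities at p=1/2 for every
conformal rectangle (no identification, no conformal invariance). Open (Grimmett1999 §9.7
conjecture; only RSW bounds on cluster points are known: discreteCrossingProb_clusterPt_mem_Ioo).
Necessary for the conjunct. -/
@[route_item "route-CriticalPhenomena-PivotalEnergyLaw", crux]
def LimitExists : Prop :=
  ∀ R : Literature.Probability.RandomPlanarGeometry.ConformalRectangle, ∃ L : ℝ, Filter.Tendsto (Literature.Probability.Percolation.bondDomainCrossingProb R) (nhdsWithin 0 (Set.Ioi 0)) (nhds L)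

/-- item stmt-CriticalPhenomena-0746 · crux · rank 6 · open · by planner
why it might fail: Vacuously true if no such f; as a step, the Camia–Newman SLE₆ identification needs crossing limits on admissible NON-Jordan (slit) domains with moving marks (math/0604487 p.14: Jordan-only 'would not be sufficient'); hypothesis is pointwise on Jordan rectangles, f ≠ Cardy a priori (κ=6 by locality).
sources: CamiaNewman2007, arXiv:math/0604487, Smirnov2001, Werner2007, LawlerSchrammWerner2001, Schramm2000
[crux] Cardy rigidity on Z^2: if the bond-Z^2 crossing probabilities of ALL conformal rectangles
converge to a function f of the cross-ratio, then f = cardyFunction on (0,1). Intended proof: with f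
as hitting kernel, Smirnov2001 Thm 2 / CamiaNewman2007 §§5-7 / Werner2007 §4 give convergence of the
exploration path (AB tightness isTightLaws_map_bondInterface, RSW rsw_half) to a conformally
invariant domain-Markov curve = SLE_κ (Schramm2000); percolation locality forces κ = 6
(LawlerSchrammWerner2001 §3, cf. eq_six_of_forall_measureReal_hitsBefore) and
sle_six_measureReal_hitsBefore returns f = F. Vacuous unless X_U holds, but provable
unconditionally. -/
@[route_item "route-CriticalPhenomena-PivotalEnergyLaw", crux]
def CardyRigidity : Prop :=
  ∀ f : ℝ → ℝ, (∀ R : Literature.Probability.RandomPlanarGeometry.ConformalRectangle, R.HasCrossingLimit (Literature.Probability.Percolation.bondDomainCrossingProb R) f) → Set.EqOn f Literature.Probability.RandomPlanarGeometry.cardyFunction (Set.Ioo 0 1)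

/-- item stmt-CriticalPhenomena-4708 · support · rank 9 · open · by planner
sources: SchrammSmirnov2011, GarbanPeteSchramm2013, BollobasRiordan2006, lean:Literature.Probability.Percolation.rsw_half_holds
[support] RSW equicontinuity at round quads, any position: for a marked disc (c,ρ,θ) and ε > 0 there
is τ > 0 such that for every ψ univalent near closedBall c ρ with |ψ′ − 1| ≤ τ on it, any R
presenting ψ(ball c ρ) with marks ψ(y_i) and any R₀ presenting the round marked disc itself have
eventually |P R δ − P R₀ δ| ≤ ε (covers translations ψ = z + w). Known technology: Schramm–Smirnov /
GPS uniform continuity of quad-crossing probabilities from RSW + boundary 3-arm bounds, on bond-ℤ²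
via rsw_half_holds. [difficulty: L] -/
@[route_item "route-CriticalPhenomena-PivotalEnergyLaw", crux]
def NearRoundContinuity : Prop :=
  ∀ (c : ℂ) (ρ : ℝ) (θ : Fin 4 → ℝ), 0 < ρ → StrictMono θ → θ 3 < θ 0 + 2 * Real.pi → ∀ ε : ℝ, 0 < ε → ∃ τ : ℝ, 0 < τ ∧ ∀ (U : Set ℂ) (ψ : ℂ → ℂ), IsOpen U → Metric.closedBall c ρ ⊆ U → DifferentiableOn ℂ ψ U → Set.InjOn ψ U → (∀ z ∈ Metric.closedBall c ρ, ‖deriv ψ z - 1‖ ≤ τ) → ∀ R R₀ : Literature.Probability.RandomPlanarGeometry.ConformalRectangle, (R.carrier = ψ '' Metric.ball c ρ ∧ ∀ i, R.pt i = ψ (c + ρ * Complex.exp (Complex.I * θ i))) → (R₀.carrier = Metric.ball c ρ ∧ ∀ i, R₀.pt i = c + ρ * Complex.exp (Complex.I * θ i)) → ∀ᶠ δ : ℝ in nhdsWithin 0 (Set.Ioi 0), |Literature.Probability.Percolation.bondDomainCrossingProb R δ - Literature.Probability.Percolation.bondDomainCrossingProb R₀ δ| ≤ ε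

/-- item stmt-CriticalPhenomena-4709 · support · rank 9 · open · by planner
sources: DKKMO2020Rotational, arXiv:2012.11672, lean:Literature.Probability.Percolation.dkkmo_rotation_invariance
[support] for the unit disc with marks e^{iθ_j} and its rotation by α, bond-ℤ² crossing
probabilities differ by o(1) as δ → 0⁺ (DKKMO 2020 rotation invariance of sub-sequential limits,
arXiv:2012.11672 Thm 1.2/Cor 1.3, transferred from the tree's loop form dkkmo_rotation_invariance to
crossing events of a disc by RSW). [difficulty: L] -/
@[route_item "route-CriticalPhenomena-PivotalEnergyLaw", crux]
def DiscRotationInvariance : Prop :=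
  ∀ (θ : Fin 4 → ℝ) (α : ℝ), StrictMono θ → θ 3 < θ 0 + 2 * Real.pi → ∀ R R' : Literature.Probability.RandomPlanarGeometry.ConformalRectangle, (R.carrier = Metric.ball 0 1 ∧ ∀ i, R.pt i = Complex.exp (Complex.I * θ i)) → (R'.carrier = Metric.ball 0 1 ∧ ∀ i, R'.pt i = Complex.exp (Complex.I * (θ i + α))) → Filter.Tendsto (fun δ : ℝ => Literature.Probability.Percolation.bondDomainCrossingProb R δ - Literature.Probability.Percolation.bondDomainCrossingProb R' δ) (nhdsWithin 0 (Set.Ioi 0)) (nhds 0)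

/-- item stmt-CriticalPhenomena-4710 · support · rank 9 · open · by planner
sources: BollobasRiordan2006, Smirnov2001, CamiaNewman2007, lean:Literature.Probability.Percolation.hasCrossingLimit_triDomainCrossingProb_holds
[support] for R with uniformizing datum (φ, x) and ε > 0 there is a marked disc (c,ρ,θ) with
closedBall c ρ ⊂ ℍ whose complex cross-ratio equals crossRatio x (so φ(disc) is an interior analytic
quad of the SAME modulus) such that every R' presenting φ(ball c ρ) with marks φ(c+ρe^{iθ_j}) has
eventually |P R δ − P R' δ| ≤ ε. Known technology: the ℤ²-bond analogue of Bollobás–Riordan Ch. 7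
Lemma 14 / (19) (interior approximating domains + RSW near the marked points), proved in the tree
for site-𝕋 (tri_exists_discreteApprox_proof). [difficulty: L] -/
@[route_item "route-CriticalPhenomena-PivotalEnergyLaw", crux]
def InnerApproximation : Prop :=
  ∀ (R : Literature.Probability.RandomPlanarGeometry.ConformalRectangle) (φ : Literature.Probability.RandomPlanarGeometry.ConformalEquiv UpperHalfPlane.upperHalfPlaneSet R.carrier) (x : Fin 4 → ℝ), R.IsUniformizing φ x → ∀ ε : ℝ, 0 < ε → ∃ (c : ℂ) (ρ : ℝ) (θ : Fin 4 → ℝ), 0 < ρ ∧ Metric.closedBall c ρ ⊆ UpperHalfPlane.upperHalfPlaneSet ∧ StrictMono θ ∧ θ 3 < θ 0 + 2 * Real.pi ∧ (c + ρ * Complex.exp (Complex.I * θ 0) - (c + ρ * Complex.exp (Complex.I * θ 1))) * (c + ρ * Complex.exp (Complex.I * θ 2) - (c + ρ * Complex.exp (Complex.I * θ 3))) = (Literature.Probability.RandomPlanarGeometry.crossRatio x : ℂ) * ((c + ρ * Complex.exp (Complex.I * θ 0) - (c + ρ * Complex.exp (Complex.I * θ 2))) * (c + ρ * Complex.exp (Complex.I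 * θ 1) - (c + ρ * Complex.exp (Complex.I * θ 3)))) ∧ ∀ R' : Literature.Probability.RandomPlanarGeometry.ConformalRectangle, (R'.carrier = φ '' Metric.ball c ρ ∧ ∀ i, R'.pt i = φ (c + ρ * Complex.exp (Complex.I * θ i))) → ∀ᶠ δ : ℝ in nhdsWithin 0 (Set.Ioi 0), |Literature.Probability.Percolation.bondDomainCrossingProb R δ - Literature.Probability.Percolation.bondDomainCrossingProb R' δ| ≤ ε

/-- item stmt-CriticalPhenomena-4711 · support · rank 9 · open · by planner
sources: Cardy1992, GrimmettPercolation1999, lean:Literature.Probability.Percolation.crossingProb_anti_left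
[support] virial (scale-covariance) identity for rectangle pushes, the card's first rung:
(N+1)(P(N,M) − P(N+1,M)) − (M+1)(P(N,M+1) − P(N,M)) → 0 uniformly for aspect in [1/2,2] ("per-site
wired-side density = per-site free-side density"; equivalently, by exact duality
P(N,M)+P(M+1,N−1)=1, symmetry of the top-push response under (N,M) ↔ (M+1,N−1)). Consequence of
SideFlatness + CornerMatching + ResponseTightness (glue foreseen); cheap transfer-matrix / kit
target on its own. [difficulty: open-problem] -/
@[route_item "route-CriticalPhenomena-PivotalEnergyLaw", crux]
def RectVirial : Prop :=
  ∀ ε : ℝ, 0 < ε → ∃ N₀ : ℕ, ∀ N M : ℕ, N₀ ≤ N → N₀ ≤ M → M ≤ 2 * N → N ≤ 2 * M → |((N : ℝ) + 1) * (Literature.Probability.Percolation.crossingProb Literature.Probability.Percolation.half N M - Literature.Probability.Percolation.crossingProb Literature.Probability.Percolation.half (N + 1) M) - ((M : ℝ) + 1) * (Literature.Probability.Percolation.crossingProb Literature.Probability.Percolation.half N (M + 1) - Literature.Probability.Percolation.crossingProb Literature.Probability.Percolation.half N M)| ≤ ε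

/-- item stmt-CriticalPhenomena-4712 · support · rank 9 · open · by planner
sources: LawlerSchrammWernerEJP2002, SmirnovWerner2001, Nolin2008, Werner2007, lean:Literature.Probability.Percolation.rsw_half_holds
[support] the one-column push response of the wired side is of exact order 1/N: c/N ≤ P(N,M) −
P(N+1,M) ≤ C/N for aspect in [1/2,2] and N ≥ N₀ (tightness and non-degeneracy of the boundary
push-response measure; upper bound = half-plane 3-arm exponent 2 plus a corner 2-arm bound, lower
bound = RSW average + regularity of the reach law). [difficulty: M] -/
@[route_item "route-CriticalPhenomena-PivotalEnergyLaw", crux]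
def ResponseTightness : Prop :=
  ∃ c C : ℝ, 0 < c ∧ ∃ N₀ : ℕ, ∀ N M : ℕ, N₀ ≤ N → N₀ ≤ M → M ≤ 2 * N → N ≤ 2 * M → c / N ≤ Literature.Probability.Percolation.crossingProb Literature.Probability.Percolation.half N M - Literature.Probability.Percolation.crossingProb Literature.Probability.Percolation.half (N + 1) M ∧ Literature.Probability.Percolation.crossingProb Literature.Probability.Percolation.half N M - Literature.Probability.Percolation.crossingProb Literature.Probability.Percolation.half (N + 1) M ≤ C / N

/-- item stmt-CriticalPhenomena-4713 · assembly · rank 1 · open · by planner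
sources: Smirnov2001, BollobasRiordan2006, SchrammSmirnov2011
[assembly] ConformalDilationCovariance → NearRoundContinuity → DiscRotationInvariance →
InnerApproximation → LimitExists → CardyRigidity → CardyFormulaZ2. -/
@[route_item "route-CriticalPhenomena-PivotalEnergyLaw", crux]
def Assembly : Prop :=
  (∀ (U : Set ℂ) (φ : ℂ → ℂ) (c p : ℂ) (ρ : ℝ) (θ : Fin 4 → ℝ), IsOpen U → DifferentiableOn ℂ φ U → Set.InjOn φ U → 0 < ρ → Metric.closedBall c ρ ⊆ U → p ∈ Metric.ball c ρ → StrictMono θ → θ 3 < θ 0 + 2 * Real.pi → ∀ s t : ℝ, s ∈ Set.Ioc (0:ℝ) 1 → t ∈ Set.Ioc (0:ℝ) 1 → ∀ R R' : Literature.Probability.RandomPlanarGeometry.ConformalRectangle, (R.carrier = φ '' Metric.ball (p + s * (c - p)) (s * ρ) ∧ ∀ i, R.pt i = φ (p + s * (c + ρ * Complex.exp (Complex.I * θ i) - p))) → (R'.carrier = φ '' Metric.ball (p + t * (c - p)) (t * ρ) ∧ ∀ i, R'.pt i = φ (p + t * (c + ρ * Complex.exp (Complex.I * θ i) - p))) →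 Filter.Tendsto (fun δ : ℝ => Literature.Probability.Percolation.bondDomainCrossingProb R (s * δ) - Literature.Probability.Percolation.bondDomainCrossingProb R' (t * δ)) (nhdsWithin 0 (Set.Ioi 0)) (nhds 0)) → (∀ (c : ℂ) (ρ : ℝ) (θ : Fin 4 → ℝ), 0 < ρ → StrictMono θ → θ 3 < θ 0 + 2 * Real.pi → ∀ ε : ℝ, 0 < ε → ∃ τ : ℝ, 0 < τ ∧ ∀ (U : Set ℂ) (ψ : ℂ → ℂ), IsOpen U → Metric.closedBall c ρ ⊆ U → DifferentiableOn ℂ ψ U → Set.InjOn ψ U → (∀ z ∈ Metric.closedBall c ρ, ‖deriv ψ z - 1‖ ≤ τ) → ∀ R R₀ : Literature.Probability.RandomPlanarGeometry.ConformalRectangle, (R.carrier = ψ '' Metric.ball c ρ ∧ ∀ i, R.pt i = ψ (c + ρ * Complex.exp (Complex.I * θ i))) → (R₀.carrier = Metric.ball c ρ ∧ ∀ i, R₀.pt i = c + ρ * Complex.exp (Complex.I * θ i)) → ∀ᶠ δ : ℝ in nhdsWithin 0 (Set.Ioi 0), |Literature.Probability.Percolation.bondDomainCrossingProb R δ - Literature.Probability.Percolation.bondDomainCrossingProb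 R₀ δ| ≤ ε) → (∀ (θ : Fin 4 → ℝ) (α : ℝ), StrictMono θ → θ 3 < θ 0 + 2 * Real.pi → ∀ R R' : Literature.Probability.RandomPlanarGeometry.ConformalRectangle, (R.carrier = Metric.ball 0 1 ∧ ∀ i, R.pt i = Complex.exp (Complex.I * θ i)) → (R'.carrier = Metric.ball 0 1 ∧ ∀ i, R'.pt i = Complex.exp (Complex.I * (θ i + α))) → Filter.Tendsto (fun δ : ℝ => Literature.Probability.Percolation.bondDomainCrossingProb R δ - Literature.Probability.Percolation.bondDomainCrossingProb R' δ) (nhdsWithin 0 (Set.Ioi 0)) (nhds 0)) → (∀ (R : Literature.Probability.RandomPlanarGeometry.ConformalRectangle) (φ : Literature.Probability.RandomPlanarGeometry.ConformalEquiv UpperHalfPlane.upperHalfPlaneSet R.carrier) (x : Fin 4 → ℝ), R.IsUniformizing φ x → ∀ ε : ℝ, 0 < ε → ∃ (c : ℂ) (ρ : ℝ) (θ : Fin 4 → ℝ), 0 < ρ ∧ Metric.closedBall c ρ ⊆ UpperHalfPlane.upperHalfPlaneSet ∧ StrictMono θ ∧ θ 3 < θ 0 + 2 * Real.pi ∧ (c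 + ρ * Complex.exp (Complex.I * θ 0) - (c + ρ * Complex.exp (Complex.I * θ 1))) * (c + ρ * Complex.exp (Complex.I * θ 2) - (c + ρ * Complex.exp (Complex.I * θ 3))) = (Literature.Probability.RandomPlanarGeometry.crossRatio x : ℂ) * ((c + ρ * Complex.exp (Complex.I * θ 0) - (c + ρ * Complex.exp (Complex.I * θ 2))) * (c + ρ * Complex.exp (Complex.I * θ 1) - (c + ρ * Complex.exp (Complex.I * θ 3)))) ∧ ∀ R' : Literature.Probability.RandomPlanarGeometry.ConformalRectangle, (R'.carrier = φ '' Metric.ball c ρ ∧ ∀ i, R'.pt i = φ (c + ρ * Complex.exp (Complex.I * θ i))) → ∀ᶠ δ : ℝ in nhdsWithin 0 (Set.Ioi 0), |Literature.Probability.Percolation.bondDomainCrossingProb R δ - Literature.Probability.Percolation.bondDomainCrossingProb R' δ| ≤ ε) → (∀ R : Literature.Probability.RandomPlanarGeometry.ConformalRectangle, ∃ L : ℝ, Filter.Tendsto (Literature.Probability.Percolation.bondDomainCrossingProb R) (nhdsWithin 0 (Set.Ioi 0)) (nhds L)) → (∀ f : ℝ → ℝ, (∀ R : Literature.Probability.RandomPlanarGeometry.ConformalRectangle,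 R.HasCrossingLimit (Literature.Probability.Percolation.bondDomainCrossingProb R) f) → Set.EqOn f Literature.Probability.RandomPlanarGeometry.cardyFunction (Set.Ioo 0 1)) → CardyFormulaZ2

/-! D-0027 §2.1 — DECIDING THEOREM (planner-authored via `route open/edit --closes-file`; by planner-rbadge-CriticalPhenomena-PivotalEnergy-3335a76c-g4-0 2026-08-15T16:10:00Z):
its hypotheses are this route's items and its conclusion the sub-problem Statement (glue_lint), and it elaborates with this file. -/

@[closes "route-CriticalPhenomena-PivotalEnergyLaw"] theorem closes (h_ConformalDilationCovariance : ConformalDilationCovariance)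
    (_h_SideFlatness : SideFlatness) (_h_CornerMatching : CornerMatching)
    (h_LimitExists : LimitExists) (h_CardyRigidity : CardyRigidity)
    (h_NearRoundContinuity : NearRoundContinuity)
    (h_DiscRotationInvariance : DiscRotationInvariance)
    (h_InnerApproximation : InnerApproximation) (_h_RectVirial : RectVirial)
    (_h_ResponseTightness : ResponseTightness) (h_Assembly : Assembly) :
    _root_.CardyFormulaZ2 :=
  -- D-0027 §2.1 deciding theorem of route PivotalEnergyLaw: all eleven items as hypotheses (route
  -- order), conclusion the sub-problem Statement. The spine is the Assembly item (a statement item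
  -- provers prove like any other: presenting-structure constructions + the exact mesh-scaling
  -- identity, no percolation estimate): ConformalDilationCovariance, NearRoundContinuity,
  -- DiscRotationInvariance, InnerApproximation, LimitExists, CardyRigidity ⟹ CardyFormulaZ2
  -- (Assembly's antecedents are these six items verbatim, so the application below type-checks by
  -- unfolding). The rectangle rungs (SideFlatness, CornerMatching, RectVirial, ResponseTightness)
  -- are the typed lattice laboratory of the energy law and are not consumed here.
  h_Assembly h_ConformalDilationCovariance h_NearRoundContinuity h_DiscRotationInvariance
    h_InnerApproximation h_LimitExists h_CardyRigidity

end Summit.CriticalPhenomena.CardyFormulaZ2.Theses.PivotalEnergyLaw
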